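import Summits.ResolutionOfSingularities.ResolutionOfSingularities.Theses.TeissierJung
import Summits.ResolutionOfSingularities.ResolutionOfSingularities.Theorems.TeissierJungDefs
import Summits.ResolutionOfSingularities.ResolutionOfSingularities.Theorems.TeissierJungTeissierReductionLowDim
import Summits.ResolutionOfSingularities.ResolutionOfSingularities.Theorems.TeissierJungTeissierReductionJungTransfer
import Summits.ResolutionOfSingularities.ResolutionOfSingularities.Theorems.TeissierJungTeissierReductionJungTransferOfJung
import Summits.ResolutionOfSingularities.ResolutionOfSingularities.Theorems.TeissierJungTeissierReductionBinomialClean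
import Summits.ResolutionOfSingularities.ResolutionOfSingularities.Theorems.TeissierJungTeissierReductionBicyclicOverblown
import Summits.ResolutionOfSingularities.ResolutionOfSingularities.Theorems.TeissierJungTeissierReductionJungModel
import Summits.ResolutionOfSingularities.ResolutionOfSingularities.Theorems.TeissierJungTeissierReductionEisensteinGerm
import Summits.ResolutionOfSingularities.ResolutionOfSingularities.Theorems.TeissierJungTeissierReductionSecondPolar
import Summits.ResolutionOfSingularities.ResolutionOfSingularities.Theorems.TeissierJungTeissierReductionStrictTransformIntegral
import Summits.ResolutionOfSingularities.ResolutionOfSingularities.Theorems.TeissierJungTeissierReductionZariskiFrameStep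
import Summits.ResolutionOfSingularities.ResolutionOfSingularities.Theorems.TeissierJungTeissierReductionZariskiFiniteValue
import Summits.ResolutionOfSingularities.ResolutionOfSingularities.Theorems.TeissierJungTeissierReductionZariskiMonomialArchimedean
import Literature.AlgebraicGeometry.Resolution.TeissierPresentation
import Literature.AlgebraicGeometry.Resolution.Principalization
import HarnessLib

/-!
# Line `Sketch` — lead skeleton v4, FINAL (crux `TeissierJung.TeissierReduction`,
stmt-ResolutionOfSingularities-17085; lead a1 cycle 1, continued by lead c1 cycle 2, 2026-08-17)

v4 = v3 with the last landed helper (`…ZariskiMonomialArchimedean`, p167351, accepted) imported and the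
terminal status recorded: the line is declared DEAD by lead c1 (`Lines/Sketch.dead.md`): its composition is
the ideator's ladder, whose stubs `stub_principalization` (principalisation on regular `d`-folds, `d ≥ 4`,
char `p`) and `stub_jungTeissierStep` (the relative Jung step, Mourtada–Schober's printed open question) are
OPEN PROBLEMS and whose `stub_lowRungs` is blocked on the named fact `CossartPiltant2019`; no reshape inside
the line reaches the open content of the typed crux (`m ≥ 5`), and the ideator itself withdrew the ladder
(route note BN2). Every bankable stub is in the tree (13 accepted `--supports` files, all imported above).
NEW in the dead note (lead c1, paper): Teissier presentability of a branch DEPENDS ON THE PROJECTION already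
for plane curves — the cusp `k⟦t², t³⟧` is Teissier-presented over `k⟦s⟧ → k⟦t², t³⟧` iff `ord_t s ∈ {2, 3}`
iff `s ∉ 𝔪²` — so the landed `stub_jungModel` projection (forms of high degree, no local control) is NOT the
projection a Jung line can use; a Jung line needs a LINEAR projection of the hypersurface (monogenic branches).

Source: the crux-ideate sketch `Cruxes/TeissierReduction/SketchIdeatorR1K2.lean` (ideator k2, r1; the only
line of the payload), reshaped into `stub_*` form, plus the first lemmas of the ideator-k1 cards
(`Cruxes/TeissierReduction/SketchIdeatorR1K1.lean`) and the provable Jung plumbing listed by the gen-1 lead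
(`Cruxes/TeissierReduction/NOTES.md` §3).

STATE AT THE END OF CYCLE 1 (lead a1): every bankable stub of the line has LANDED (ten `--supports` files,
all imported above — all sorry-free with axioms ⊆ {propext, Classical.choice, Quot.sound}); what remains
registered is the COMPOSITION — the ideator's ladder — whose three stubs are
* `stub_lowRungs` (BLOCKED on the named fact `CossartPiltant2019`; conditional discharge in tree,
  `teissierReduction_conclusion_of_le_four`, p158399; `m ≤ 2` unconditional),
* `stub_principalization` (OPEN PROBLEM: principalisation on regular excellent `d`-folds, `d ≥ 4`, char `p`),
* `stub_jungTeissierStep` (OPEN PROBLEM = the crux in relative costume: Mourtada–Schober's printed open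
  step, `PrincipalizationInDim d → TeissierReductionAmbient (d+1)`, `d ≥ 4`).
Nothing a prover can move is left inside this line; the two open-core stubs are crux-sized
(`promote-stub` material) and the ideator itself withdrew the ladder to route note BN2. New lines must
come from the five crux idea cards (`Cruxes/TeissierReduction/Ideas/*.md`), whose first lemmas are now
all in the tree (below).

LANDED by this line (lead gen a1, cycle 1; `--supports stmt-…-17085`):
* `stub_binomialClean` — p164293 `Theorems/TeissierJungTeissierReductionBinomialClean.lean`
  (card `toric-jung-newton-generic`, terminal-point lemma: `Λ[z]/(z^q − c x^A (1+m))` is Teissier, `g = 1`);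
* `stub_bicyclicOverblown` — p164820 `…BicyclicOverblown.lean` (BN1 positive: `Λ[y₁,y₂]/(y₁²−x₁, y₂²−x₁ⁿx₂)`
  is Teissier in the loose form, `g = 2`; public `isPrime_span_bicyclic`);
* `stub_jungModel` — p164354 `…JungModel.lean` (finite surjective `H → ℙ^{dim H}`; public, any field:
  `exists_finite_surjective_projSpace_of_isClosedImmersion`);
* `stub_eisensteinGerm` — p164530 `…EisensteinGerm.lean` (card `maclane-fan-residual-induction` L1:
  Eisenstein Weierstrass polynomials are Teissier, `g = 1`; public `isPrime_span_X_pow_sub_C_mul_X`);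
* `stub_secondPolar` — p164389 `…SecondPolar.lean` (card `codim-one-residual-separability` L2);
* `stub_strictTransformIntegral` — p164346 `…StrictTransformIntegral.lean` (card `transversal-strict-transform` L1);
* `stub_jungTransfer` — p165643 `…JungTransferOfJung.lean` (`TeissierReductionJung → TeissierReduction`;
  registered via `stub-add`; definitions `TeissierPresentedOver`/`TeissierReductionJung` in
  `Theorems/TeissierJungDefs.lean`, p163658);
* `stub_zariskiFrameStep` — p166474 `…ZariskiFrameStep.lean`, `stub_zariskiFiniteValue` — p166014
  `…ZariskiFiniteValue.lean`, `stub_zariskiMonomialArchimedean` — `…ZariskiMonomialArchimedean.lean`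
  (card `valuative-koenig-surfaces` L1, CORRECTED: the ideator's `exists_iterated_quadraticTransform_monomial`
  is FALSE without excluding the non-Japanese infinite-value branch — worker counterexample over Nagata's
  DVR; the Archimedean case is now a theorem, the curve-composite case (needs excellence) is the next
  engine a `valuative-koenig` line must build).
Gen-1 groundwork: p158399 (`…LowDim.lean`: the crux's conclusion for `m ≤ 2`, and `m ≤ 4` mod CP2019),
p158903 (`…JungTransfer.lean`: `teissierReduction_of_jungSquares`, the Jung-square backbone).
-/

-- single-problem summit: the doubled namespace component `ResolutionOfSingularities` is forced
set_option linter.dupNamespace false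

noncomputable section

open CategoryTheory CategoryTheory.Limits AlgebraicGeometry TopologicalSpace
open Literature.AlgebraicGeometry.Resolution
open Literature.AlgebraicGeometry.Motives (projectiveSpace)
open Summit.ResolutionOfSingularities.ResolutionOfSingularities.Theses.TeissierJung
open Summit.ResolutionOfSingularities.ResolutionOfSingularities.Theorems.TeissierReduction

namespace Summit.ResolutionOfSingularities.ResolutionOfSingularities.Cruxes.TeissierReduction.Lines.Sketch

/-! ## Vocabulary of the ladder (ideator k2, verbatim) -/

/-- **Principalization in dimension `d`** — the shape of Cossart–Piltant 2019 Prop. 4.4 (in tree as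
the named fact `CossartPiltant2019Principalization`, the case `d = 3`) with `3 ↦ d`: on every regular
excellent integral Noetherian scheme of dimension `d`, every nonzero ideal sheaf is principalized by
a finite sequence of blowing ups along regular integral centres in its non-principal locus. Open for
`d ≥ 4` in characteristic `p`. -/
def PrincipalizationInDim (d : ℕ) : Prop :=
  ∀ (S : Scheme.{0}) [IsIntegral S] [IsNoetherian S], Scheme.IsRegular S → Scheme.IsExcellent S →
    topologicalKrullDim S = d → ∀ J : S.IdealSheafData, J ≠ ⊥ →
      ∃ (S' : Scheme.{0}) (σ : S' ⟶ S), IsRegularCentreBlowupSeq σ J ∧ IsLocallyPrincipal (J.comap σ)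

/-- **The crux's conclusion in a fixed ambient dimension `m`** (`H ⊆ ℙᵐ_k`), with the let-bound `TF`
replaced by the Literature predicate `TeissierPresented` (bridge `teissierPresented_iff`). -/
def TeissierReductionAmbient (m : ℕ) : Prop :=
  ∀ p : ℕ, p.Prime → ∀ (k : Type) [Field k] [CharP k p] [IsAlgClosed k]
    (H : Scheme.{0}) (ι' : H ⟶ (projectiveSpace m k).left),
    IsClosedImmersion ι' → IsIntegral H →
    (∀ y : (projectiveSpace m k).left, ∃ U : (projectiveSpace m k).left.affineOpens,
      y ∈ (U : (projectiveSpace m k).left.Opens) ∧ (ι'.ker.ideal U).IsPrincipal) →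
    ∃ (X' : Scheme.{0}) (ρ : X' ⟶ H), IsProper ρ ∧ IsBirational ρ ∧ TeissierPresented k X'

/-- **The RELATIVE crux (one rung of the Jung ladder).** Principalization on regular `d`-folds ⇒
Teissier reduction for `d`-dimensional hypersurfaces `H ⊆ ℙ^{d+1}`. -/
def JungTeissierStep (d : ℕ) : Prop :=
  PrincipalizationInDim d → TeissierReductionAmbient (d + 1)

/-- `TeissierReduction` is the conjunction of its fixed-ambient-dimension instances (ideator k2, proved). -/
theorem teissierReduction_iff_forall_ambient :
    TeissierReduction ↔ ∀ m, TeissierReductionAmbient m := by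
  constructor
  · intro h m p hp k _ _ _ H ι' hι hH hpr
    obtain ⟨X', ρ, h1, h2, h3⟩ := h p hp k m H ι' hι hH hpr
    exact ⟨X', ρ, h1, h2, (teissierPresented_iff k X').2 h3⟩
  · intro h p hp k _ _ _ TF m H ι' hι hH hpr
    obtain ⟨X', ρ, h1, h2, h3⟩ := h m p hp k H ι' hι hH hpr
    exact ⟨X', ρ, h1, h2, (teissierPresented_iff k X').1 h3⟩

/-- **Ladder assembly (logic only; ideator k2, proved).** -/
theorem teissierReduction_of_ladder
    (hlow : ∀ m, m ≤ 4 → TeissierReductionAmbient m)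
    (hprinc : ∀ d, 4 ≤ d → PrincipalizationInDim d)
    (hstep : ∀ d, 4 ≤ d → JungTeissierStep d) :
    TeissierReduction := by
  refine teissierReduction_iff_forall_ambient.2 fun m => ?_
  by_cases hm : m ≤ 4
  · exact hlow m hm
  · obtain ⟨d, rfl⟩ : ∃ d, m = d + 1 := ⟨m - 1, by omega⟩
    exact hstep d (by omega) (hprinc d (by omega))

/-- The rungs `m ≤ 2` of `stub_lowRungs` hold unconditionally (gen-1 lead, p158399). -/
theorem teissierReductionAmbient_of_le_two {m : ℕ} (hm : m ≤ 2) : TeissierReductionAmbient m := by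
  intro p hp k _ _ _ H ι' hι hH _
  haveI := hι
  haveI := hH
  exact teissierReduction_conclusion_of_le_two hm H ι'

/-- The rungs `m ≤ 4` of `stub_lowRungs` hold modulo `CossartPiltant2019` (gen-1 lead, p158399): the
conditional discharge of the blocked stub. -/
theorem teissierReductionAmbient_of_le_four (hCP : CossartPiltant2019.{0}) {m : ℕ} (hm : m ≤ 4) :
    TeissierReductionAmbient m := by
  intro p hp k _ _ _ H ι' hι hH _
  haveI := hι
  haveI := hH
  exact teissierReduction_conclusion_of_le_four hCP (p := p) hm H ι'

/-! ## Composition stubs (the open core) -/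

/-- STUB `stub_lowRungs` (held by the lead; BLOCKED on the named fact `CossartPiltant2019` for
`m = 3, 4` — `teissierReductionAmbient_of_le_four`; `m ≤ 2` unconditional —
`teissierReductionAmbient_of_le_two`). The crux's conclusion for `H ⊆ ℙᵐ_k`, `m ≤ 4`. -/
theorem stub_lowRungs : ∀ m, m ≤ 4 → TeissierReductionAmbient m := by
  sorry

/-- STUB `stub_principalization` (OPEN CORE, held by the lead). Principalisation of nonzero ideal
sheaves on regular excellent integral Noetherian schemes of every dimension `d ≥ 4` by blow-ups in
regular centres (Cossart–Piltant 2019 Prop. 4.4 is `d = 3`; open for `d ≥ 4` in positive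
characteristic — it follows from embedded resolution in dimension `d`). -/
theorem stub_principalization : ∀ d, 4 ≤ d → PrincipalizationInDim d := by
  sorry

/-- STUB `stub_jungTeissierStep` (OPEN CORE, held by the lead; the hardest stub). The relative crux:
for `d ≥ 4`, principalisation on regular `d`-folds implies Teissier reduction of `d`-dimensional
hypersurfaces `H ⊆ ℙ^{d+1}_k` — Mourtada–Schober's printed open step (C. R. Math. 363 (2025) p. 4)
in relative form. -/
theorem stub_jungTeissierStep : ∀ d, 4 ≤ d → JungTeissierStep d := by
  sorry

/-! ## The composition: the crux BY NAME, sorry-free modulo the three composition stubs -/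

/-- **Line `Sketch` closes the crux modulo its stubs**: `TeissierReduction` from `stub_lowRungs`,
`stub_principalization`, `stub_jungTeissierStep` by the ideator's ladder. -/
theorem TeissierReduction_of : TeissierReduction :=
  teissierReduction_of_ladder stub_lowRungs stub_principalization stub_jungTeissierStep

end Summit.ResolutionOfSingularities.ResolutionOfSingularities.Cruxes.TeissierReduction.Lines.Sketch

end
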